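import Mathlib.Analysis.Calculus.Deriv.Pow
import Mathlib.Analysis.Calculus.MeanValue
import Literature.Barriers.CriticalPhenomena.RigorousRGSmallParameterTestFunctionNorm
import HarnessLib

/-!
# `RigorousRGSmallParameter` (Slade, Theorem 1.4.1): the `T_φ` seminorm of [BS-rg-norm] —
# V. Brydges–Slade Proposition 3.6.1 (polynomial norm estimate
# `‖F‖_{T_φ} ≤ ‖F‖_{T_0}(1 + ‖φ‖_Φ)^A`) via Lemma 5.3.1 (the Taylor shift `σ*`)

Sequel of `RigorousRGSmallParameterTphiSeminorm.lean`, `…TphiCalculus.lean`,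
`…TestFunctionNorm.lean` (see the first for the sources and architecture). Brydges–Slade,
Proposition 3.6.1: "If `F` is a polynomial of degree `A ≤ p_𝒩` then
`‖F‖_{T_φ} ≤ ‖F‖_{T_0}(1 + ‖φ‖_Φ)^A`" — the comparison of the `T_φ` and `T_0` seminorms for
polynomials in the field, used with the product property and Proposition 3.4.6 throughout the
stability analysis [BS-rg-IE] behind Slade's Theorem 6.3.1. Its printed proof (§5.3) rests on
Lemma 5.3.1: the Taylor shift `σ*_ξ(s)` of test functions,
`(σ*_ξ(s)g)_z = Σ_{(z',z'') ∈ B_z} (z!/(z'!z''!)) s^{z''}ξ^{z''}g_{z'}` over the splittings of `z`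
into a concatenation `z'∘z''`, satisfies `⟨P, g⟩_{tφ+sξ} = ⟨P, σ*_ξ(s)g⟩_{tφ}` for polynomials `P`
(proof: the exact Taylor expansion `P_{z'}(tφ+sξ) = Σ_{z''} (1/z''!)P_{z'∘z''}(tφ)s^{z''}ξ^{z''}`
and a regrouping), and `‖σ*_ξ(1)g‖_{Φ^{(p)}} ≤ (1+‖ξ‖_Φ)^p‖g‖_Φ` (products of test functions,
the display after Example 3.3.2). This file formalises exactly this at `t = 0`, `s = 1`, for one
real boson species and the lattice norms `Φ(𝔥)` of file III (the field `ξ = Σ_x c_x e_x` entering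
through the unit-ball estimates "`‖ξ‖_Φ ≤ C`": `|∇^βc_x| ≤ C𝔥R^{-|β|}`):

* `lineDeriv`, `hasDerivAt_lineDeriv`, `taylor_exact_of_deriv_chain`, **`coeff_apply_eq_taylor`** —
  the exact Taylor expansion of the coefficients of a polynomial `F ∈ 𝒩` (all `F_z`, `|z| > A`,
  vanish) along `t ↦ tξ`: `F_{z'}(ξ) = Σ_{k≤A}(1/k!)Σ_{|z''|=k} c^{z''}F_{z''∘z'}(0)` (the
  `(A+1)`-st derivative along the line vanishes and `Σ_k D_k(t)(1-t)^k/k!` is constant);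
* `sigmaT` (the truncated `σ*_ξ(1)`), `taylorTerm`, **`pairing_coeff_eq_pairing_sigmaT`** —
  Lemma 5.3.1: `⟨F, g⟩_ξ = ⟨F, σg⟩_0`;
* `tensorPow`, `napply_tensorPow_le` (`‖c^{⊗k}‖ ≤ C^k`), **`sigmaT_polar`** —
  `‖σg‖_Φ ≤ (1+C)^A` on `B(Φ)` (binomial theorem);
* **`TphiNorm_le_TphiNorm_zero_mul`** — Proposition 3.6.1 for Slade's `T_{φ,j}(𝔥_j)`.

Everything is proved; no named fact. Ledger effect: none on the trust base of the barrier's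
reduction chain (`Slade2017_prop822`).
-/

noncomputable section

namespace Literature.Barriers.CriticalPhenomena

namespace LongRangePhi4

namespace Tphi

open Finset

variable {Ξ : Type*}

/-! ## Brydges–Slade Proposition 3.6.1: `‖F‖_{T_φ} ≤ ‖F‖_{T_0}(1 + ‖φ‖_Φ)^A` for polynomials -/

section polyTaylor

open scoped ContDiff

variable {E : Type*} [NormedAddCommGroup E] [NormedSpace ℝ E]
variable [Fintype Ξ]

/-- `c^{z} = ∏_k c_{z_k}`. [folklore] -/
def cpow (c : Ξ → ℝ) (z : List Ξ) : ℝ := (z.map c).prod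

omit [Fintype Ξ] in
/-- `c^{a·z} = c_a c^z`. [folklore] -/
@[simp] theorem cpow_cons (c : Ξ → ℝ) (a : Ξ) (z : List Ξ) : cpow c (a :: z) = c a * cpow c z := by
  simp [cpow]

omit [Fintype Ξ] in
/-- `c^∅ = 1`. [folklore] -/
@[simp] theorem cpow_nil (c : Ξ → ℝ) : cpow c [] = 1 := by simp [cpow]

/-- The `k`-th derivative along the line `t ↦ tv`, `v = Σ_x c_x e_x`, in coefficient form:
`D_k(t) = Σ_{|w|=k} c^w F_w(tv)`. [folklore] -/
def lineDeriv (e : Ξ → E) (c : Ξ → ℝ) (F : E → ℝ) (k : ℕ) (t : ℝ) : ℝ :=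
  sumSeq k (fun w => cpow c w * coeff e w F (t • ∑ x, c x • e x))

/-- The derivative of `t ↦ K(tv)` is `Σ_x c_x (∂_{e_x}K)(tv)` for `v = Σ_x c_x e_x`. [folklore] -/
theorem hasDerivAt_comp_line (e : Ξ → E) (c : Ξ → ℝ) {K : E → ℝ} (hK : ContDiff ℝ ∞ K) (t : ℝ) :
    HasDerivAt (fun s : ℝ => K (s • ∑ x, c x • e x))
      (∑ x, c x * dirDeriv (e x) K (t • ∑ x, c x • e x)) t := by
  set v : E := ∑ x, c x • e x with hv
  have h1 : HasDerivAt (fun s : ℝ => s • v) v t := by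
    simpa using (hasDerivAt_id t).smul_const v
  have h2 : HasFDerivAt K (fderiv ℝ K (t • v)) (t • v) :=
    ((differentiable_of_contDiff hK) _).hasFDerivAt
  have h3 := h2.comp_hasDerivAt t h1
  have h4 : (fderiv ℝ K (t • v)) v = ∑ x, c x * dirDeriv (e x) K (t • v) := by
    simp only [hv, map_sum, map_smul, smul_eq_mul, dirDeriv]
  rw [h4] at h3
  exact h3

/-- `sumSeq` of derivatives: termwise `HasDerivAt` gives `HasDerivAt` of the sum. [folklore] -/
theorem hasDerivAt_sumSeq : ∀ (k : ℕ) {G G' : List Ξ → ℝ → ℝ} {t : ℝ},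
    (∀ w : List Ξ, w.length = k → HasDerivAt (G w) (G' w t) t) →
      HasDerivAt (fun s => sumSeq k (fun w => G w s)) (sumSeq k (fun w => G' w t)) t
  | 0, G, G', t, h => by simpa using h [] rfl
  | k + 1, G, G', t, h => by
      simp only [sumSeq_succ]
      refine HasDerivAt.fun_sum fun a _ => ?_
      exact hasDerivAt_sumSeq k fun w hw => h (a :: w) (by simp [hw])

/-- **`D_k' = D_{k+1}`** along the line. [folklore] -/
theorem hasDerivAt_lineDeriv (e : Ξ → E) (c : Ξ → ℝ) {F : E → ℝ} (hF : ContDiff ℝ ∞ F) (k : ℕ) (t : ℝ) :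
    HasDerivAt (lineDeriv e c F k) (lineDeriv e c F (k + 1) t) t := by
  unfold lineDeriv
  rw [sumSeq_succ]
  have h := hasDerivAt_sumSeq (Ξ := Ξ) k (t := t)
    (G := fun w s => cpow c w * coeff e w F (s • ∑ x, c x • e x))
    (G' := fun w s => cpow c w * ∑ x, c x * dirDeriv (e x) (coeff e w F) (s • ∑ x, c x • e x))
    (fun w _ => (hasDerivAt_comp_line e c (contDiff_coeff e hF w) t).const_mul (cpow c w))
  convert h using 1
  rw [← sumSeq_sum]
  refine sumSeq_congr k fun w _ => ?_
  rw [Finset.mul_sum]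
  refine Finset.sum_congr rfl fun x _ => ?_
  rw [cpow_cons, coeff_cons]
  ring

/-- `D_0(t) = F(tv)`. [folklore] -/
theorem lineDeriv_zero (e : Ξ → E) (c : Ξ → ℝ) (F : E → ℝ) (t : ℝ) :
    lineDeriv e c F 0 t = F (t • ∑ x, c x • e x) := by
  simp [lineDeriv]

/-- For a polynomial of degree `≤ A` (all coefficients of length `> A` vanish identically),
`D_{A+1} ≡ 0`. [folklore] -/
theorem lineDeriv_eq_zero_of_poly (e : Ξ → E) (c : Ξ → ℝ) {F : E → ℝ} {A : ℕ}
    (hpoly : ∀ z : List Ξ, A < z.length → ∀ ψ, coeff e z F ψ = 0) (t : ℝ) :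
    lineDeriv e c F (A + 1) t = 0 := by
  unfold lineDeriv
  rw [sumSeq_congr (A + 1) (g := fun _ => 0), sumSeq_zero_fun]
  intro w hw
  rw [hpoly w (by omega), mul_zero]

/-- **Exact Taylor expansion of a polynomial along a line**: if `D_0 = g`, `D_k' = D_{k+1}` and
`D_{K+1} ≡ 0`, then `g(1) = Σ_{k ≤ K} D_k(0)/k!` (the function
`h(t) = Σ_{k≤K} D_k(t)(1-t)^k/k!` has zero derivative). [folklore] -/
theorem taylor_exact_of_deriv_chain {D : ℕ → ℝ → ℝ} {K : ℕ}
    (hD : ∀ k t, HasDerivAt (D k) (D (k + 1) t) t) (hK : ∀ t, D (K + 1) t = 0) :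
    D 0 1 = ∑ k ∈ range (K + 1), D k 0 / (k.factorial : ℝ) := by
  set h : ℝ → ℝ := fun t => ∑ k ∈ range (K + 1), D k t * (1 - t) ^ k / (k.factorial : ℝ) with hh
  -- derivative of `h` vanishes
  have hderiv : ∀ t, HasDerivAt h 0 t := by
    intro t
    have hterm : ∀ k, HasDerivAt (fun s => D k s * (1 - s) ^ k / (k.factorial : ℝ))
        ((D (k + 1) t * (1 - t) ^ k - D k t * (k * (1 - t) ^ (k - 1))) / (k.factorial : ℝ)) t := by
      intro k
      have h1 := hD k t
      have h2 : HasDerivAt (fun s : ℝ => (1 - s) ^ k) (k * (1 - t) ^ (k - 1) * (-1)) t := by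
        have := HasDerivAt.fun_pow ((hasDerivAt_id t).const_sub 1) k
        simpa using this
      have h3 := (h1.mul h2).div_const (k.factorial : ℝ)
      exact h3.congr_deriv (by ring)
    have hsum := HasDerivAt.fun_sum (u := range (K + 1)) fun k _ => hterm k
    -- telescoping
    have tel : ∀ n : ℕ, ∑ k ∈ range (n + 1),
        (D (k + 1) t * (1 - t) ^ k - D k t * (k * (1 - t) ^ (k - 1))) / (k.factorial : ℝ) =
        D (n + 1) t * (1 - t) ^ n / (n.factorial : ℝ) := by
      intro n
      induction n with
      | zero => simp
      | succ n ih =>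
        rw [Finset.sum_range_succ, ih]
        simp only [Nat.add_sub_cancel, Nat.factorial_succ, Nat.cast_mul, Nat.cast_add, Nat.cast_one]
        have hn : ((n.factorial : ℕ) : ℝ) ≠ 0 := by positivity
        have hn1 : ((n : ℝ) + 1) ≠ 0 := by positivity
        field_simp
        ring
    have hz : (0 : ℝ) = ∑ k ∈ range (K + 1),
        (D (k + 1) t * (1 - t) ^ k - D k t * (k * (1 - t) ^ (k - 1))) / (k.factorial : ℝ) := by
      rw [tel K, hK t, zero_mul, zero_div]
    rw [hz]
    exact hsum
  -- so `h` is constant: `h 1 = h 0`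
  have hconst : h 1 = h 0 := by
    have hdiff : Differentiable ℝ h := fun t => (hderiv t).differentiableAt
    have hd0 : ∀ t, deriv h t = 0 := fun t => (hderiv t).deriv
    exact is_const_of_deriv_eq_zero hdiff hd0 1 0
  have h1 : h 1 = D 0 1 := by
    simp only [hh]
    rw [Finset.sum_eq_single 0]
    · simp
    · intro k _ hk
      simp [zero_pow hk]
    · intro h0; simp at h0
  have h0 : h 0 = ∑ k ∈ range (K + 1), D k 0 / (k.factorial : ℝ) := by
    simp only [hh, sub_zero, one_pow, mul_one]
  rw [← h1, hconst, h0]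

/-- **Taylor's formula for the coefficients of a polynomial** `F ∈ 𝒩` of degree `≤ A`: for every
sequence `z'` and `v = Σ_x c_x e_x`,
`F_{z'}(v) = Σ_{k ≤ A} (1/k!) Σ_{|z''|=k} c^{z''} F_{z''∘z'}(0)` (the expansion
`P_{z'}(tφ + sξ) = Σ_{z''} (1/z''!) P_{z'∘z''}(tφ) s^{z''}ξ^{z''}` in the proof of Lemma 5.3.1 of
[BS-rg-norm], at `t = 0`, `s = 1`). [cite: BrydgesSlade2015RGI, Lemma 5.3.1 (proof, first display)] -/
theorem coeff_apply_eq_taylor (e : Ξ → E) (c : Ξ → ℝ) {F : E → ℝ} (hF : ContDiff ℝ ∞ F) {A : ℕ}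
    (hpoly : ∀ z : List Ξ, A < z.length → ∀ ψ, coeff e z F ψ = 0) (z' : List Ξ) :
    coeff e z' F (∑ x, c x • e x) =
      ∑ k ∈ range (A + 1), ((k.factorial : ℝ)⁻¹) *
        sumSeq k (fun z'' => cpow c z'' * coeff e (z'' ++ z') F 0) := by
  -- apply the exact Taylor expansion to `H = F_{z'}`, a polynomial of degree `≤ A`
  set H := coeff e z' F with hH
  have hHs : ContDiff ℝ ∞ H := contDiff_coeff e hF z'
  have hcoeff : ∀ w : List Ξ, coeff e w H = coeff e (w ++ z') F := by
    intro w
    induction w with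
    | nil => rfl
    | cons a w ih => rw [coeff_cons, ih, List.cons_append, coeff_cons]
  have hHpoly : ∀ w : List Ξ, A < w.length → ∀ ψ, coeff e w H ψ = 0 := by
    intro w hw ψ
    rw [hcoeff]
    exact hpoly _ (by simp; omega) ψ
  have hchain := fun k t => hasDerivAt_lineDeriv e c hHs k t
  have hzero := lineDeriv_eq_zero_of_poly e c hHpoly
  have h := taylor_exact_of_deriv_chain (D := lineDeriv e c H) (K := A) hchain hzero
  rw [lineDeriv_zero, one_smul] at h
  rw [h]
  refine Finset.sum_congr rfl fun k _ => ?_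
  rw [div_eq_inv_mul]
  congr 1
  simp only [lineDeriv, zero_smul]
  exact sumSeq_congr k fun w _ => by rw [hcoeff]

end polyTaylor


section sigmaTransform

open scoped ContDiff

variable [Fintype Ξ]

/-- `Σ_{|w| = k + r} Φ(w) = Σ_{|u|=k} Σ_{|v|=r} Φ(u ∘ v)`. [folklore] -/
theorem sumSeq_append {M' : Type*} [AddCommMonoid M'] : ∀ (k r : ℕ) (Φ : List Ξ → M'),
    sumSeq (k + r) Φ = sumSeq k (fun u => sumSeq r (fun v => Φ (u ++ v)))
  | 0, r, Φ => by simp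
  | k + 1, r, Φ => by
      rw [show k + 1 + r = (k + r) + 1 by omega, sumSeq_succ, sumSeq_succ]
      refine Finset.sum_congr rfl fun a _ => ?_
      rw [sumSeq_append k r]
      rfl

/-- The truncated **Taylor shift of a test function** (the `σ*_ξ(1)g` of Lemma 5.3.1 of
[BS-rg-norm] at `t = 0`, bosonic case, truncated at length `A`):
`(σg)_w = Σ_{k=0}^{|w|} binom(|w|,k) c^{w_{≤k}} g_{w_{>k}}` for `|w| ≤ A`, and `0` beyond.
[cite: BrydgesSlade2015RGI, §5.3 (display (sigmastardef))] -/
def sigmaT (A : ℕ) (c : Ξ → ℝ) (g : List Ξ → ℝ) : List Ξ → ℝ := fun w =>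
  if A < w.length then 0
  else ∑ k ∈ range (w.length + 1), (w.length.choose k : ℝ) * (cpow c (w.take k) * g (w.drop k))

omit [Fintype Ξ] in
/-- `σg` vanishes beyond length `A`. [folklore] -/
theorem sigmaT_eq_zero_of_lt {A : ℕ} (c : Ξ → ℝ) (g : List Ξ → ℝ) {w : List Ξ} (hw : A < w.length) :
    sigmaT A c g w = 0 := by
  simp [sigmaT, hw]

/-- The summand common to both sides of Lemma 5.3.1: `S(k,r) = (k!r!)⁻¹ Σ_{|w|=k+r} c^{w_{≤k}} F_w(0) g_{w_{>k}}`. [folklore] -/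
def taylorTerm {E : Type*} [NormedAddCommGroup E] [NormedSpace ℝ E] (e : Ξ → E) (c : Ξ → ℝ)
    (F : E → ℝ) (g : List Ξ → ℝ) (k r : ℕ) : ℝ :=
  ((k.factorial : ℝ)⁻¹ * (r.factorial : ℝ)⁻¹) *
    sumSeq (k + r) (fun w => cpow c (w.take k) * coeff e w F 0 * g (w.drop k))

/-- Nested `sumSeq` commute. [folklore] -/
theorem sumSeq_sumSeq_comm {M' : Type*} [AddCommMonoid M'] (k : ℕ) : ∀ (r : ℕ) (f : List Ξ → List Ξ → M'),
    sumSeq r (fun z => sumSeq k (fun u => f u z)) = sumSeq k (fun u => sumSeq r (fun z => f u z))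
  | 0, f => by simp
  | r + 1, f => by
      rw [sumSeq_succ]
      rw [Finset.sum_congr rfl fun a _ => sumSeq_sumSeq_comm k r (fun u z => f u (a :: z)), ← sumSeq_sum]
      rfl

/-- Left-hand side of Lemma 5.3.1 in terms of `S(k,r)`. [folklore] -/
theorem pairing_coeff_eq_sum_taylorTerm {E : Type*} [NormedAddCommGroup E] [NormedSpace ℝ E]
    (e : Ξ → E) (c : Ξ → ℝ) {F : E → ℝ} (hF : ContDiff ℝ ∞ F) {A : ℕ} (pN : ℕ)
    (hpoly : ∀ z : List Ξ, A < z.length → ∀ ψ, coeff e z F ψ = 0) (g : List Ξ → ℝ) :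
    pairing pN (coeffFamily e F (∑ x, c x • e x)) g =
      ∑ r ∈ range (pN + 1), ∑ k ∈ range (A + 1), taylorTerm e c F g k r := by
  unfold pairing
  refine Finset.sum_congr rfl fun r _ => ?_
  have h1 : sumSeq r (fun z => coeffFamily e F (∑ x, c x • e x) z * g z) =
      sumSeq r (fun z => ∑ k ∈ range (A + 1), ((k.factorial : ℝ)⁻¹) *
        sumSeq k (fun u => cpow c u * coeff e (u ++ z) F 0 * g z)) := by
    refine sumSeq_congr r fun z _ => ?_
    simp only [coeffFamily]
    rw [coeff_apply_eq_taylor e c hF hpoly z, Finset.sum_mul]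
    refine Finset.sum_congr rfl fun k _ => ?_
    rw [mul_assoc]
    congr 1
    rw [mul_comm, ← sumSeq_mul_left]
    exact sumSeq_congr k fun u _ => by ring
  rw [h1, sumSeq_sum, Finset.mul_sum]
  refine Finset.sum_congr rfl fun k _ => ?_
  unfold taylorTerm
  have hc := sumSeq_sumSeq_comm k r (fun u z => cpow c u * coeff e (u ++ z) F 0 * g z)
  rw [sumSeq_append k r, sumSeq_mul_left, hc, ← mul_assoc, mul_comm ((r.factorial : ℝ)⁻¹)]
  congr 1
  refine sumSeq_congr k fun u hu => sumSeq_congr r fun v _ => ?_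
  rw [List.take_append_of_le_length (by omega), List.take_of_length_le (by omega),
    List.drop_append_of_le_length (by omega), List.drop_of_length_le (by omega), List.nil_append]

/-- Right-hand side of Lemma 5.3.1 in terms of `S(k,r)`. [folklore] -/
theorem pairing_sigmaT_eq_sum_taylorTerm {E : Type*} [NormedAddCommGroup E] [NormedSpace ℝ E]
    (e : Ξ → E) (c : Ξ → ℝ) (F : E → ℝ) {A pN : ℕ} (hA : A ≤ pN) (g : List Ξ → ℝ) :
    pairing pN (coeffFamily e F 0) (sigmaT A c g) =
      ∑ m ∈ range (A + 1), ∑ kl ∈ antidiagonal m, taylorTerm e c F g kl.1 kl.2 := by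
  unfold pairing
  -- restrict the length to `m ≤ A`
  rw [← Finset.sum_range_add_sum_Ico _ (show A + 1 ≤ pN + 1 by omega)]
  rw [Finset.sum_eq_zero (s := Finset.Ico (A + 1) (pN + 1)) (fun m hm => by
    rw [Finset.mem_Ico] at hm
    rw [sumSeq_congr m (g := fun _ => 0), sumSeq_zero_fun, mul_zero]
    intro w hw
    rw [sigmaT_eq_zero_of_lt c g (by omega), mul_zero]), add_zero]
  refine Finset.sum_congr rfl fun m hm => ?_
  rw [Finset.mem_range] at hm
  have h1 : sumSeq m (fun z => coeffFamily e F 0 z * sigmaT A c g z) =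
      sumSeq m (fun w => ∑ k ∈ range (m + 1),
        (m.choose k : ℝ) * (cpow c (w.take k) * coeff e w F 0 * g (w.drop k))) := by
    refine sumSeq_congr m fun w hw => ?_
    simp only [coeffFamily, sigmaT, hw, show ¬ A < m by omega, if_false, Finset.mul_sum]
    refine Finset.sum_congr rfl fun k _ => ?_
    ring
  rw [h1, sumSeq_sum, Finset.mul_sum, Nat.sum_antidiagonal_eq_sum_range_succ
    (fun k l => taylorTerm e c F g k l) m]
  refine Finset.sum_congr rfl fun k hk => ?_
  rw [Finset.mem_range] at hk
  unfold taylorTerm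
  rw [show k + (m - k) = m by omega, sumSeq_mul_left, ← mul_assoc]
  congr 1
  have hk' : k ≤ m := by omega
  have hc : (m.choose k : ℝ) * (k.factorial : ℝ) * ((m - k).factorial : ℝ) = m.factorial := by
    exact_mod_cast Nat.choose_mul_factorial_mul_factorial hk'
  have h1 : (k.factorial : ℝ) ≠ 0 := by positivity
  have h2 : ((m - k).factorial : ℝ) ≠ 0 := by positivity
  have h3 : (m.factorial : ℝ) ≠ 0 := by positivity
  field_simp
  linarith [hc]

/-- **`⟨F, g⟩_v = ⟨F, σg⟩_0`** for a polynomial `F` of degree `≤ A ≤ p_𝒩` and `v = Σ_x c_x e_x`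
(Lemma 5.3.1 of [BS-rg-norm], display (sigstar), at `t = 0`, `s = 1`).
[cite: BrydgesSlade2015RGI, Lemma 5.3.1 (display ⟨P,g⟩_{tφ+sξ} = ⟨P, σ*_ξ(s)g⟩_{tφ})] -/
theorem pairing_coeff_eq_pairing_sigmaT {E : Type*} [NormedAddCommGroup E] [NormedSpace ℝ E]
    (e : Ξ → E) (c : Ξ → ℝ) {F : E → ℝ} (hF : ContDiff ℝ ∞ F) {A pN : ℕ} (hA : A ≤ pN)
    (hpoly : ∀ z : List Ξ, A < z.length → ∀ ψ, coeff e z F ψ = 0) (g : List Ξ → ℝ) :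
    pairing pN (coeffFamily e F (∑ x, c x • e x)) g = pairing pN (coeffFamily e F 0) (sigmaT A c g) := by
  have hS0 : ∀ k r, A < k + r → taylorTerm e c F g k r = 0 := by
    intro k r hkr
    unfold taylorTerm
    rw [sumSeq_congr (k + r) (g := fun _ => 0), sumSeq_zero_fun, mul_zero]
    intro w hw
    rw [hpoly w (by omega), mul_zero, zero_mul]
  rw [pairing_coeff_eq_sum_taylorTerm e c hF pN hpoly g, pairing_sigmaT_eq_sum_taylorTerm e c F hA g,
    sum_range_antidiagonal]
  -- LHS: restrict `r ≤ A` and insert the vanishing indicator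
  rw [← Finset.sum_range_add_sum_Ico _ (show A + 1 ≤ pN + 1 by omega)]
  rw [Finset.sum_eq_zero (s := Finset.Ico (A + 1) (pN + 1)) (fun r hr => by
    rw [Finset.mem_Ico] at hr
    exact Finset.sum_eq_zero fun k _ => hS0 k r (by omega)), add_zero, Finset.sum_comm]
  refine Finset.sum_congr rfl fun k _ => Finset.sum_congr rfl fun r _ => ?_
  split_ifs with h
  · rfl
  · exact hS0 k r (by omega)

end sigmaTransform

section prop361

open scoped ContDiff

variable {Λ : Type*} [AddCommGroup Λ] {ι : Type*} {S : Type*} (step : S → Λ)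

/-- Tensor powers `c^{⊗k}` of a one-argument test function, supported on length `k`. [folklore] -/
def tensorPow (c : Λ × ι → ℝ) (k : ℕ) : List (Λ × ι) → ℝ := fun u => if u.length = k then cpow c u else 0

omit [AddCommGroup Λ] in
/-- `c^{⊗(k+1)} = c ⊗ c^{⊗k}`. [folklore] -/
theorem tensorPow_succ (c : Λ × ι → ℝ) (k : ℕ) : tensorPow c (k + 1) = prodFn 1 k (liftFn c) (tensorPow c k) := by
  funext w
  unfold tensorPow prodFn
  by_cases hw : w.length = k + 1
  · rw [if_pos hw, if_pos (by omega)]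
    obtain ⟨a, w', rfl⟩ : ∃ a w', w = a :: w' := by
      cases w with
      | nil => simp at hw
      | cons a w' => exact ⟨a, w', rfl⟩
    simp only [List.length_cons, add_left_inj] at hw
    simp [hw]
  · rw [if_neg hw, if_neg (by omega)]

/-- **`‖c^{⊗k}‖_Φ ≤ ‖c‖_Φ^k`**: the unit-ball estimates for tensor powers. [cite: BrydgesSlade2015RGI, §3.3 (display ‖g‖_Φ ≤ ‖g'‖_{Φ^{(r)}}‖g''‖_Φ, iterated)] -/
theorem napply_tensorPow_le [Fintype Λ] [Fintype ι] {𝔥 R : ℝ} (h𝔥 : 0 < 𝔥) (hR : 0 < R) {pΦ : ℕ}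
    (c : Λ × ι → ℝ) {C : ℝ} (hC : 0 ≤ C)
    (hc : ∀ (x : Λ × ι) (β : List (ℕ × S)), Adm pΦ 1 β → |napply step β (liftFn c) [x]| ≤ C * 𝔥 * (R ^ β.length)⁻¹) :
    ∀ (k : ℕ) (u : List (Λ × ι)), u.length = k → ∀ β : List (ℕ × S), Adm pΦ k β →
      |napply step β (tensorPow c k) u| ≤ C ^ k * 𝔥 ^ k * (R ^ β.length)⁻¹
  | 0, u, hu, β, hβ => by
      have hu' : u = [] := List.eq_nil_of_length_eq_zero hu
      have hβ' : β = [] := by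
        cases β with
        | nil => rfl
        | cons q β => exact absurd (hβ.1 q (by simp)) (Nat.not_lt_zero _)
      subst hu' hβ'
      simp [tensorPow]
  | k + 1, u, hu, β, hβ => by
      have hpol := prodFn_polar step h𝔥 hR hC (pow_nonneg hC k) (r := 1) (r' := k) (g' := liftFn c)
        (g'' := tensorPow c k)
        (fun u hu β hβ => by
          match u, hu with
          | [x], _ => simpa using hc x β hβ)
        (fun v hv β hβ => napply_tensorPow_le h𝔥 hR c hC hc k v hv β hβ)
      have hadm : Adm pΦ u.length β := by rw [hu]; exact hβ
      have h := hpol _ (latticeFun_mem step 𝔥 R hadm)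
      rw [latticeFun_apply, ← tensorPow_succ, hu] at h
      have h1 : 0 < 𝔥 ^ (k + 1) := pow_pos h𝔥 _
      have h2 : 0 < R ^ β.length := pow_pos hR _
      rw [abs_mul, abs_mul, abs_inv, abs_of_pos h1, abs_of_pos h2, mul_assoc, inv_mul_le_iff₀ h1] at h
      rw [le_mul_inv_iff₀ h2]
      calc |napply step β (tensorPow c (k + 1)) u| * R ^ β.length
          = R ^ β.length * |napply step β (tensorPow c (k + 1)) u| := mul_comm _ _
        _ ≤ 𝔥 ^ (k + 1) * (C * C ^ k) := h
        _ = C ^ (k + 1) * 𝔥 ^ (k + 1) := by ring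

omit [AddCommGroup Λ] in
/-- On sequences of length `m ≤ A`, `σg` is the binomial combination of the products
`c^{⊗k} ⊗ g`. [folklore] -/
theorem sigmaT_eq_sum_prodFn {A : ℕ} (c : Λ × ι → ℝ) (g : List (Λ × ι) → ℝ) {m : ℕ} (hm : m ≤ A)
    {w : List (Λ × ι)} (hw : w.length = m) :
    sigmaT A c g w = ∑ k ∈ range (m + 1), (m.choose k : ℝ) * prodFn k (m - k) (tensorPow c k) g w := by
  simp only [sigmaT, hw, show ¬ A < m by omega, if_false]
  refine Finset.sum_congr rfl fun k hk => ?_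
  rw [Finset.mem_range] at hk
  congr 1
  simp only [prodFn, tensorPow, List.length_take, hw]
  rw [if_pos (by omega), if_pos (by omega)]

/-- **`‖σg‖_Φ ≤ (1 + ‖c‖_Φ)^A` on `B(Φ)`** (the bound `‖σ*_ξ(1)g‖_{Φ^{(p)}} ≤ (1+‖ξ‖_Φ)^p‖g‖_Φ` of
Lemma 5.3.1 of [BS-rg-norm], for the truncated shift, in polar form).
[cite: BrydgesSlade2015RGI, Lemma 5.3.1 (display ‖σ*_ξ(1)g‖_{Φ^{(p)}} ≤ (1+‖ξ‖_Φ)^p‖g‖_Φ)] -/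
theorem sigmaT_polar [Fintype Λ] [Fintype ι] {𝔥 R : ℝ} (h𝔥 : 0 < 𝔥) (hR : 0 < R) {pΦ pN A : ℕ}
    (c : Λ × ι → ℝ) {C : ℝ} (hC : 0 ≤ C)
    (hc : ∀ (x : Λ × ι) (β : List (ℕ × S)), Adm pΦ 1 β → |napply step β (liftFn c) [x]| ≤ C * 𝔥 * (R ^ β.length)⁻¹)
    {g : List (Λ × ι) → ℝ} (hg : g ∈ ball pN (latticeFamily step 𝔥 R pΦ)) :
    ∀ ℓ ∈ latticeFamily step 𝔥 R pΦ, |ℓ.toFun (sigmaT A c g)| ≤ (1 + C) ^ A := by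
  rintro _ ⟨β, w, hβ, rfl⟩
  by_cases hA : A < w.length
  · -- beyond length `A` the shifted test function vanishes on the relevant length
    rw [(latticeFun step 𝔥 R β w).local' (sigmaT A c g) (fun _ => 0) (fun z hz => by
      exact sigmaT_eq_zero_of_lt c g (by simp [latticeFun] at hz; omega))]
    rw [show (fun _ : List (Λ × ι) => (0:ℝ)) = 0 from rfl, map_zero, abs_zero]
    positivity
  · push Not at hA
    set m := w.length with hm
    -- locality: replace `σg` by the binomial combination of `prodFn`s on length `m`
    rw [(latticeFun step 𝔥 R β w).local' (sigmaT A c g)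
      (fun w' => ∑ k ∈ range (m + 1), (m.choose k : ℝ) * prodFn k (m - k) (tensorPow c k) g w')
      (fun z hz => sigmaT_eq_sum_prodFn c g hA (by simpa [latticeFun] using hz))]
    rw [show (fun w' => ∑ k ∈ range (m + 1), (m.choose k : ℝ) * prodFn k (m - k) (tensorPow c k) g w') =
      ∑ k ∈ range (m + 1), ((m.choose k : ℝ) • prodFn k (m - k) (tensorPow c k) g) from by
        funext w'; simp [Finset.sum_apply, smul_eq_mul], map_sum]
    refine (Finset.abs_sum_le_sum_abs _ _).trans ?_
    calc ∑ k ∈ range (m + 1), |(latticeFun step 𝔥 R β w).toFun ((m.choose k : ℝ) • prodFn k (m - k) (tensorPow c k) g)|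
        ≤ ∑ k ∈ range (m + 1), (m.choose k : ℝ) * (C ^ k * 1) := by
          refine Finset.sum_le_sum fun k hk => ?_
          rw [map_smul, smul_eq_mul, abs_mul, Nat.abs_cast]
          refine mul_le_mul_of_nonneg_left ?_ (Nat.cast_nonneg _)
          have hkm : k + (m - k) = m := by rw [Finset.mem_range] at hk; omega
          refine prodFn_polar step h𝔥 hR (pow_nonneg hC k) zero_le_one
            (fun u hu β' hβ' => napply_tensorPow_le step h𝔥 hR c hC hc k u hu β' hβ')
            (fun v hv β' hβ' => ?_) _ ⟨β, w, hβ, rfl⟩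
          have hadm : Adm pΦ v.length β' := by rw [hv]; exact hβ'
          have := abs_napply_le_of_mem_ball step h𝔥 hR hg hadm
          rw [hv] at this
          rw [one_mul]
          exact this
      _ = (C + 1) ^ m := by
          rw [add_pow]
          refine Finset.sum_congr rfl fun k _ => ?_
          ring
      _ ≤ (1 + C) ^ A := by
          rw [add_comm]
          exact pow_le_pow_right₀ (by linarith) hA

/-- **Brydges–Slade, Proposition 3.6.1 (polynomial norm estimate), for the lattice norms
`Φ(𝔥)` (Slade's `T_{φ,j}(𝔥)`)**: if `F ∈ 𝒩` is a polynomial of degree `A ≤ p_𝒩` (all coefficients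
`F_z`, `|z| > A`, vanish) then `‖F‖_{T_φ} ≤ ‖F‖_{T_0}(1 + ‖φ‖_Φ)^A`, the field `φ = Σ_x c_x e_x`
entering through the unit-ball estimates `|∇^β c_x| ≤ C𝔥R^{-|β|}` ("`‖φ‖_Φ ≤ C`"). Proof as
printed (§5.3): `⟨F, g⟩_φ = ⟨F, σ*g⟩_0` (Lemma 5.3.1, `pairing_coeff_eq_pairing_sigmaT`) and
`‖σ*g‖ ≤ (1+‖φ‖_Φ)^A‖g‖` (`sigmaT_polar`).
[cite: BrydgesSlade2015RGI, Proposition 3.6.1 and its proof in §5.3] -/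
theorem TphiNorm_le_TphiNorm_zero_mul [Fintype Λ] [Fintype ι] {E : Type*} [NormedAddCommGroup E]
    [NormedSpace ℝ E] {𝔥 R : ℝ} (h𝔥 : 0 < 𝔥) (hR : 0 < R) {pΦ pN A : ℕ} (hApN : A ≤ pN)
    (e : Λ × ι → E) {F : E → ℝ} (hF : ContDiff ℝ ∞ F)
    (hpoly : ∀ z : List (Λ × ι), A < z.length → ∀ ψ, coeff e z F ψ = 0)
    (c : Λ × ι → ℝ) {C : ℝ} (hC : 0 ≤ C)
    (hc : ∀ (x : Λ × ι) (β : List (ℕ × S)), Adm pΦ 1 β → |napply step β (liftFn c) [x]| ≤ C * 𝔥 * (R ^ β.length)⁻¹) :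
    TphiNorm pN (latticeFamily step 𝔥 R pΦ) e F (∑ x, c x • e x) ≤
      TphiNorm pN (latticeFamily step 𝔥 R pΦ) e F 0 * (1 + C) ^ A := by
  unfold TphiNorm
  refine Tnorm_le fun g hg => ?_
  unfold coeffFamily
  rw [show (fun z => coeff e z F (∑ x, c x • e x)) = coeffFamily e F (∑ x, c x • e x) from rfl,
    pairing_coeff_eq_pairing_sigmaT e c hF hApN hpoly g]
  exact abs_pairing_le_Tnorm_mul (latticeFamily_evalBound step h𝔥 hR pΦ pN) _
    (fun z hz => sigmaT_eq_zero_of_lt c g (by omega)) (sigmaT_polar step h𝔥 hR c hC hc hg)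
    (by positivity)

end prop361

end Tphi

end LongRangePhi4

end Literature.Barriers.CriticalPhenomena

end
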